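import Summits.AtomisticToContinuum.Crystallization.Theses.ChessboardParticlePlanes
import Summits.AtomisticToContinuum.Crystallization.Theorems.ChessboardParticlePlanesLjPlaneChessboardLayerModes
import Summits.AtomisticToContinuum.Crystallization.Theorems.ChessboardParticlePlanesLjPlaneChessboardSliceSwap

/-!
# Crux `ChessboardParticlePlanes.LjPlaneChessboard` (stmt-AtomisticToContinuum-6709), line `Sketch`,
# stub `layerSum_planar` — a layer sum in planar coordinates

Let `Q` be a periodic configuration of `ℝ³`, `a, b ∈ Q.lattice` two horizontal (`a 2 = b 2 = 0`)
`ℝ`-independent periods, and let the occupied plane `{y ∈ Q.points | y 2 = s}` be presented as the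
disjoint union of the cosets `f + ℤa + ℤb` of finitely many representatives `f ∈ F` of height `s`
(the output format of `layerCosets`).  Let `L ⊆ ℝ²` be the planar lattice of the integer
combinations `k πa + l πb` of the projections `πa = !₂[a 0, a 1]`, `πb = !₂[b 0, b 1]`, and write
`π y = !₂[y 0, y 1]`.  Then for every `x ∈ ℝ³` and every vertical offset `ζ > 0`

* each planar lattice sum `Σ_{v ∈ L} V_LJ(√(‖πx − πf − v‖² + ζ²))` converges, and
* `Σ'_{y ∈ Q.points, y 2 = s} V_LJ(√(‖x − y‖² − (x 2 − s)² + ζ²))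
     = Σ_{f ∈ F} Σ'_{v ∈ L} V_LJ(√(‖πx − πf − v‖² + ζ²))`.

PROOF.  Summability: `R_v = √(‖X − v‖² + ζ²) ≥ ζ > 0` and `R_v⁻⁶ ≤ C (1 + ‖v‖)⁻⁶`
(`inv_sqrt_norm_sub_sq_add_sq_pow_six_le`) is summable over a lattice of the plane
(`Fourier.summable_of_decay_zlattice`, `6 > 2`), whence `Σ_v V_LJ(R_v)` converges
(`summable_lennardJones_of_le`).  Identity: the layer is the disjoint union over `f ∈ F` of the
ranges of the injective maps `(k, l) ↦ f + k a + l b` (injective because `a, b` are independent;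
disjoint because the representatives are pairwise inequivalent modulo `ℤa + ℤb`), so the layer sum
is the finite sum of the coset sums (`Summable.tsum_finset_bUnion_disjoint`, `tsum_range`); the map
`(k, l) ↦ k πa + l πb` is a bijection `ℤ² ≃ L` (injective because `πa, πb` are independent, which
follows from the independence of the horizontal vectors `a, b`), so each coset sum is re-indexed by
`L` (`Equiv.tsum_eq`); and pointwise, for `y = f + k a + l b` of height `s`,
`‖x − y‖² − (x 2 − s)² = (x 0 − y 0)² + (x 1 − y 1)² = ‖πx − πf − (k πa + l πb)‖²`
(`EuclideanSpace.norm_sq_eq`).  No definition and no notation is introduced. [folklore]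
-/

noncomputable section

namespace Summit.AtomisticToContinuum.Crystallization.Theorems.ChessboardParticlePlanesLjPlaneChessboard

open Literature.MathematicalPhysics.StatisticalMechanics

section LayerSumPlanar

variable {a b : EuclideanSpace ℝ (Fin 3)}

/-- Horizontal/vertical Pythagoras: for `y = f + k a + l b` with `a, b` horizontal and `f 2 = s`,
`‖x − y‖² − (x 2 − s)² = ‖πx − πf − (k πa + l πb)‖²`, where `π y = !₂[y 0, y 1]`. [folklore] -/
theorem layerSumPlanar_norm_sq (ha2 : a 2 = 0) (hb2 : b 2 = 0) {f : EuclideanSpace ℝ (Fin 3)}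
    {s : ℝ} (hf2 : f 2 = s) (x : EuclideanSpace ℝ (Fin 3)) (k l : ℤ) :
    ‖x - (f + (k : ℝ) • a + (l : ℝ) • b)‖ ^ 2 - (x 2 - s) ^ 2 =
      ‖!₂[x 0, x 1] - !₂[f 0, f 1] - ((k : ℝ) • !₂[a 0, a 1] + (l : ℝ) • !₂[b 0, b 1])‖ ^ 2 := by
  rw [EuclideanSpace.norm_sq_eq, EuclideanSpace.norm_sq_eq, Fin.sum_univ_three, Fin.sum_univ_two]
  simp only [PiLp.sub_apply, PiLp.add_apply, PiLp.smul_apply, Matrix.cons_val_zero,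
    Matrix.cons_val_one, Real.norm_eq_abs, sq_abs, smul_eq_mul, ha2, hb2, ← hf2]
  ring

/-- The translates `f + k a + l b`, `k, l ∈ ℤ`, of a point by two `ℝ`-independent vectors are
pairwise distinct: `(k, l) ↦ f + k a + l b` is injective. [folklore] -/
theorem layerSumPlanar_comb_injective (hab : LinearIndependent ℝ ![a, b])
    (f : EuclideanSpace ℝ (Fin 3)) :
    Function.Injective (fun kl : ℤ × ℤ => f + (kl.1 : ℝ) • a + (kl.2 : ℝ) • b) := by
  intro p q hpq
  have hpq' : f + (p.1 : ℝ) • a + (p.2 : ℝ) • b = f + (q.1 : ℝ) • a + (q.2 : ℝ) • b := hpq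
  have h : ((p.1 : ℝ) - q.1) • a + ((p.2 : ℝ) - q.2) • b = 0 := by
    have e : ((p.1 : ℝ) - q.1) • a + ((p.2 : ℝ) - q.2) • b =
        (f + (p.1 : ℝ) • a + (p.2 : ℝ) • b) - (f + (q.1 : ℝ) • a + (q.2 : ℝ) • b) := by
      rw [sub_smul, sub_smul]
      abel
    rw [e, hpq', sub_self]
  obtain ⟨h1, h2⟩ := LinearIndependent.pair_iff.1 hab _ _ h
  exact Prod.ext (by exact_mod_cast sub_eq_zero.1 h1) (by exact_mod_cast sub_eq_zero.1 h2)

/-- The planar projections `πa = !₂[a 0, a 1]`, `πb = !₂[b 0, b 1]` of two horizontal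
`ℝ`-independent vectors are `ℝ`-independent: `s πa + t πb = 0 → s = t = 0` (the third coordinate
of `s a + t b` vanishes automatically). [folklore] -/
theorem layerSumPlanar_proj_pair (ha2 : a 2 = 0) (hb2 : b 2 = 0) (hab : LinearIndependent ℝ ![a, b])
    (s t : ℝ) (h : s • !₂[a 0, a 1] + t • !₂[b 0, b 1] = 0) : s = 0 ∧ t = 0 := by
  refine LinearIndependent.pair_iff.1 hab s t ?_
  have h0 := congrArg (fun v : EuclideanSpace ℝ (Fin 2) => v 0) h
  have h1 := congrArg (fun v : EuclideanSpace ℝ (Fin 2) => v 1) h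
  simp only [PiLp.add_apply, PiLp.smul_apply, PiLp.zero_apply, Matrix.cons_val_zero,
    Matrix.cons_val_one, smul_eq_mul] at h0 h1
  ext i
  fin_cases i
  · simpa using h0
  · simpa using h1
  · simp [ha2, hb2]

/-- Summability of a planar Lennard-Jones lattice sum at positive height: for a full lattice `L` of
the plane, `X ∈ ℝ²` and `ζ > 0`, `Σ_{v ∈ L} V_LJ(√(‖X − v‖² + ζ²))` converges, by comparison of
`R_v⁻⁶`, `R_v = √(‖X − v‖² + ζ²) ≥ ζ`, with `C (1 + ‖v‖)⁻⁶`
(`inv_sqrt_norm_sub_sq_add_sq_pow_six_le`, `Fourier.summable_of_decay_zlattice`,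
`summable_lennardJones_of_le`). [folklore] -/
theorem layerSumPlanar_summable (L : Submodule ℤ (EuclideanSpace ℝ (Fin 2))) [DiscreteTopology L]
    [IsZLattice ℝ L] (X : EuclideanSpace ℝ (Fin 2)) {ζ : ℝ} (hζ : 0 < ζ) :
    Summable fun v : L =>
      lennardJones (Real.sqrt (‖X - (v : EuclideanSpace ℝ (Fin 2))‖ ^ 2 + ζ ^ 2)) := by
  have hb6 : (Module.finrank ℝ (EuclideanSpace ℝ (Fin 2)) : ℝ) < 6 := by
    rw [finrank_euclideanSpace_fin]; norm_num
  have hR6 : Summable fun v : L =>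
      (Real.sqrt (‖X - (v : EuclideanSpace ℝ (Fin 2))‖ ^ 2 + ζ ^ 2))⁻¹ ^ 6 := by
    have h := Literature.NumberTheory.LFunctions.Fourier.summable_of_decay_zlattice L hb6
      (g := fun v => (((Real.sqrt (‖X - v‖ ^ 2 + ζ ^ 2))⁻¹ ^ 6 : ℝ) : ℂ)) fun v => by
        rw [Complex.norm_real, Real.norm_of_nonneg (by positivity)]
        exact inv_sqrt_norm_sub_sq_add_sq_pow_six_le hζ X v
    exact Complex.summable_ofReal.1 h
  exact summable_lennardJones_of_le hζ (fun v => Real.le_sqrt_of_sq_le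
    (by nlinarith [sq_nonneg ‖X - (v : EuclideanSpace ℝ (Fin 2))‖])) hR6

end LayerSumPlanar

/-- **Stub `layerSum_planar` — a layer sum in planar coordinates.**  For a periodic configuration
`Q` of `ℝ³`, horizontal `ℝ`-independent periods `a, b`, a finite set `F ⊆ Q.points ∩ {x₂ = s}` of
representatives, pairwise inequivalent modulo `ℤa + ℤb`, whose cosets `f + ℤa + ℤb` exhaust the
occupied plane `{x₂ = s}`, the planar lattice `L = ℤ πa + ℤ πb` (`πy = !₂[y 0, y 1]`), `ζ > 0`
and any `x`: every planar lattice sum `Σ_{v ∈ L} V_LJ(√(‖πx − πf − v‖² + ζ²))` converges and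
`Σ'_{y ∈ Q.points, y 2 = s} V_LJ(√(‖x − y‖² − (x 2 − s)² + ζ²))
  = Σ_{f ∈ F} Σ'_{v ∈ L} V_LJ(√(‖πx − πf − v‖² + ζ²))`. [folklore] -/
theorem layerSum_planar :
    ∀ (Q : PeriodicConfiguration 3) (a b : EuclideanSpace ℝ (Fin 3))
      (F : Finset (EuclideanSpace ℝ (Fin 3))) (s ζ : ℝ) (x : EuclideanSpace ℝ (Fin 3))
      (L : Submodule ℤ (EuclideanSpace ℝ (Fin 2))) [DiscreteTopology L] [IsZLattice ℝ L],
      a ∈ Q.lattice → b ∈ Q.lattice → a 2 = 0 → b 2 = 0 → LinearIndependent ℝ ![a, b] →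
      (∀ v : EuclideanSpace ℝ (Fin 2),
        v ∈ L ↔ ∃ k l : ℤ, v = (k : ℝ) • !₂[a 0, a 1] + (l : ℝ) • !₂[b 0, b 1]) →
      (∀ f ∈ F, f 2 = s ∧ f ∈ Q.points) →
      (∀ f ∈ F, ∀ f' ∈ F, f ≠ f' → ∀ k l : ℤ, f' ≠ f + (k : ℝ) • a + (l : ℝ) • b) →
      (∀ y : EuclideanSpace ℝ (Fin 3),
        (y ∈ Q.points ∧ y 2 = s) ↔ ∃ f ∈ F, ∃ k l : ℤ, y = f + (k : ℝ) • a + (l : ℝ) • b) →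
      0 < ζ →
      (∀ f ∈ F, Summable (fun v : L =>
        lennardJones (Real.sqrt (‖!₂[x 0, x 1] - !₂[f 0, f 1] - (v : EuclideanSpace ℝ (Fin 2))‖ ^ 2
          + ζ ^ 2)))) ∧
      ∑' y : {y : EuclideanSpace ℝ (Fin 3) // y ∈ Q.points ∧ y 2 = s},
          lennardJones (Real.sqrt (‖x - y.1‖ ^ 2 - (x 2 - s) ^ 2 + ζ ^ 2)) =
        ∑ f ∈ F, ∑' v : L,
          lennardJones (Real.sqrt (‖!₂[x 0, x 1] - !₂[f 0, f 1] - (v : EuclideanSpace ℝ (Fin 2))‖ ^ 2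
            + ζ ^ 2)) := by
  intro Q a b F s ζ x L _ _ _ _ ha2 hb2 hab hL hF hne hlayer hζ
  refine ⟨fun f _ => layerSumPlanar_summable L _ hζ, ?_⟩
  -- notation: the summand `G` on `ℝ³` and the coset parametrisations `u f : ℤ² → ℝ³`
  set G : EuclideanSpace ℝ (Fin 3) → ℝ := fun y =>
    lennardJones (Real.sqrt (‖x - y‖ ^ 2 - (x 2 - s) ^ 2 + ζ ^ 2)) with hG
  set u : EuclideanSpace ℝ (Fin 3) → ℤ × ℤ → EuclideanSpace ℝ (Fin 3) :=
    fun f kl => f + (kl.1 : ℝ) • a + (kl.2 : ℝ) • b with hu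
  -- integer coordinates on `L`: `ψ (k, l) = k πa + l πb` is a bijection `ℤ² ≃ L`
  have hψinj : Function.Injective (fun kl : ℤ × ℤ =>
      (⟨(kl.1 : ℝ) • !₂[a 0, a 1] + (kl.2 : ℝ) • !₂[b 0, b 1],
        (hL _).2 ⟨kl.1, kl.2, rfl⟩⟩ : L)) := by
    intro p q hpq
    have h : (p.1 : ℝ) • !₂[a 0, a 1] + (p.2 : ℝ) • !₂[b 0, b 1] =
        (q.1 : ℝ) • !₂[a 0, a 1] + (q.2 : ℝ) • !₂[b 0, b 1] := congrArg Subtype.val hpq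
    have h0 : ((p.1 : ℝ) - q.1) • !₂[a 0, a 1] + ((p.2 : ℝ) - q.2) • !₂[b 0, b 1] = 0 := by
      have e : ((p.1 : ℝ) - q.1) • !₂[a 0, a 1] + ((p.2 : ℝ) - q.2) • !₂[b 0, b 1] =
          ((p.1 : ℝ) • !₂[a 0, a 1] + (p.2 : ℝ) • !₂[b 0, b 1]) -
            ((q.1 : ℝ) • !₂[a 0, a 1] + (q.2 : ℝ) • !₂[b 0, b 1]) := by
        rw [sub_smul, sub_smul]
        abel
      rw [e, h, sub_self]
    obtain ⟨h1, h2⟩ := layerSumPlanar_proj_pair ha2 hb2 hab _ _ h0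
    exact Prod.ext (by exact_mod_cast sub_eq_zero.1 h1) (by exact_mod_cast sub_eq_zero.1 h2)
  have hψsurj : Function.Surjective (fun kl : ℤ × ℤ =>
      (⟨(kl.1 : ℝ) • !₂[a 0, a 1] + (kl.2 : ℝ) • !₂[b 0, b 1],
        (hL _).2 ⟨kl.1, kl.2, rfl⟩⟩ : L)) := by
    intro v
    obtain ⟨k, l, hkl⟩ := (hL v).1 v.2
    exact ⟨(k, l), Subtype.ext hkl.symm⟩
  set ψ : ℤ × ℤ ≃ L := Equiv.ofBijective _ ⟨hψinj, hψsurj⟩ with hψ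
  -- pointwise: the coset summand is the planar summand (horizontal/vertical Pythagoras)
  have hcoset : ∀ f ∈ F, ∀ kl : ℤ × ℤ, G (u f kl) = lennardJones (Real.sqrt
      (‖!₂[x 0, x 1] - !₂[f 0, f 1] - (ψ kl : EuclideanSpace ℝ (Fin 2))‖ ^ 2 + ζ ^ 2)) := by
    intro f hf kl
    simp only [hG, hu, hψ, Equiv.ofBijective_apply]
    rw [layerSumPlanar_norm_sq ha2 hb2 (hF f hf).1 x kl.1 kl.2]
  -- each coset sum, re-indexed by `ℤ²` and then by `L`, is a planar lattice sum
  have hS : ∀ f ∈ F, Summable (fun kl : ℤ × ℤ => G (u f kl)) := by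
    intro f hf
    refine ((ψ.summable_iff).2 (layerSumPlanar_summable L (!₂[x 0, x 1] - !₂[f 0, f 1]) hζ)).congr
      fun kl => ?_
    simp only [Function.comp_apply]
    exact (hcoset f hf kl).symm
  have hT : ∀ f ∈ F, ∑' y : Set.range (u f), G y =
      ∑' v : L, lennardJones (Real.sqrt
        (‖!₂[x 0, x 1] - !₂[f 0, f 1] - (v : EuclideanSpace ℝ (Fin 2))‖ ^ 2 + ζ ^ 2)) := by
    intro f hf
    rw [tsum_range G (layerSumPlanar_comb_injective hab f), ← Equiv.tsum_eq ψ]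
    exact tsum_congr (hcoset f hf)
  have hTs : ∀ f ∈ F, Summable (G ∘ (↑) : Set.range (u f) → ℝ) := by
    intro f hf
    refine (Equiv.ofInjective (u f) (layerSumPlanar_comb_injective hab f)).summable_iff.1 ?_
    simpa only [Function.comp_def, Equiv.ofInjective_apply] using hS f hf
  -- the cosets of distinct representatives are disjoint
  have hd : (F : Set (EuclideanSpace ℝ (Fin 3))).Pairwise
      (Function.onFun Disjoint fun f => Set.range (u f)) := by
    intro f hf f' hf' hff'
    change Disjoint (Set.range (u f)) (Set.range (u f'))
    refine Set.disjoint_left.2 ?_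
    rintro y ⟨⟨k, l⟩, rfl⟩ ⟨⟨k', l'⟩, h⟩
    refine hne f hf f' hf' hff' (k - k') (l - l') ?_
    simp only [hu] at h
    have e : f' = (f' + (k' : ℝ) • a + (l' : ℝ) • b) - (k' : ℝ) • a - (l' : ℝ) • b := by abel
    rw [e, h]
    push_cast
    rw [sub_smul, sub_smul]
    abel
  -- the layer is the union of the cosets
  have hU : ∀ y : EuclideanSpace ℝ (Fin 3),
      (y ∈ Q.points ∧ y 2 = s) ↔ y ∈ ⋃ f ∈ F, Set.range (u f) := by
    intro y
    rw [hlayer y]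
    simp only [Set.mem_iUnion, Set.mem_range, Prod.exists, hu, exists_prop]
    constructor
    · rintro ⟨f, hf, k, l, h⟩
      exact ⟨f, hf, k, l, h.symm⟩
    · rintro ⟨f, hf, k, l, h⟩
      exact ⟨f, hf, k, l, h.symm⟩
  calc ∑' y : {y : EuclideanSpace ℝ (Fin 3) // y ∈ Q.points ∧ y 2 = s}, G y.1
      = ∑' y : (⋃ f ∈ F, Set.range (u f) : Set (EuclideanSpace ℝ (Fin 3))), G y :=
        Equiv.tsum_eq (Equiv.subtypeEquivRight hU) (fun y => G y.1)
    _ = ∑ f ∈ F, ∑' y : Set.range (u f), G y :=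
        Summable.tsum_finset_bUnion_disjoint (f := G) hd hTs
    _ = _ := Finset.sum_congr rfl hT

end Summit.AtomisticToContinuum.Crystallization.Theorems.ChessboardParticlePlanesLjPlaneChessboard

end
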